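import Literature.AlgebraicGeometry.Resolution.Hauser2010
import Mathlib.Algebra.MvPolynomial.Eval
import Mathlib.Order.WithBot
import HarnessLib

/-!
# The δ-invariant `δ_L(g, y, u)` of the characteristic polyhedron `Δ(g, y, u)` for a MULTI-VARIABLE pivot block `y` (Cossart–Jannsen–Saito, LNM 2270, Def. 8.1 (2)–(3), Def. 8.2 (1), (3); Hironaka 1967)

Topic: `Literature/AlgebraicGeometry/Resolution`. DEFINITIONS (coordinate level, explicit polynomials) + elementary lemmas.

Setup (CJS Ch. 7 «Setup A», specialised to a polynomial ring): the variables are SPLIT into a pivot block `y = (y_i)_{i ∈ ι}` and a base block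
`u = (u_j)_{j ∈ κ}`; a polynomial `g = Σ_{(A,B)} C_{A,B} y^B u^A` is read off its support. `n_(u)(g)` = the order of `g mod ⟨u⟩` (CJS (7.2), p. 108) —
here `yOrderModU g := ord₀ (g|_{u = 0})`. For a linear form `L` on the base exponents and an integer `n` (standing for `n_(u)(g)`):
`δ_L(g, y, u) := min { L(A) / (n − |B|) : C_{A,B} ≠ 0, |B| < n }` (CJS Def. 8.2 (3), p. 118), valued in `WithTop ℚ` (`⊤` iff no monomial of `g` has
`|B| < n`, i.e. `Δ(g, y, u) = ∅`); `δ(g, y, u) := δ_{L₀}` with `L₀(A) = |A| = a_1 + ⋯ + a_e` (CJS Def. 8.1 (3), the δ-invariant of the polyhedron). The polyhedron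
`Δ(g, y, u)` itself (Def. 8.2 (1): the smallest F-subset containing the points `A / (n − |B|)`) is not materialised here; `δ_L` is its support function at `L`, which is
what the invariants of CJS Ch. 11 and Hironaka's `δ` read. The SINGLE-pivot case (`ι` a point, `g` monic in one variable `X`) is the tree's
`Literature.AlgebraicGeometry.Resolution.CossartPiltant.delta` (`ArithmeticalThreefoldsLocalPolyhedron.lean`, local-ring level, `EReal`-valued); this file is the multi-pivot,
polynomial-level counterpart and does not restate that one.

Sources: V. Cossart, U. Jannsen, S. Saito, *Desingularization: Invariants and Strategy*, LNM 2270 (2020), Ch. 7 (7.2)–(7.3), Def. 8.1, Def. 8.2 [CossartJannsenSaito2020];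
H. Hironaka, *Characteristic polyhedra of singularities*, J. Math. Kyoto Univ. 7 (1967) [Hironaka1967] (the original `Δ(f; u; y)`). AI transcription, weaker than expert
review; definitions are coordinate-level renderings, documented as such.
-/

namespace Literature.AlgebraicGeometry.Resolution.CossartJannsenSaito

open MvPolynomial
open Literature.AlgebraicGeometry.Resolution.Hauser2010 (ordZero)

universe u

variable {K : Type u} [CommSemiring K] {ι κ : Type} [Fintype ι] [Fintype κ]

/-- `|B|` — the total degree of an exponent in the PIVOT block `y` (CJS (7.3): `g = Σ C_{A,B} y^B u^A`). [cite: CossartJannsenSaito2020, Ch. 7 (7.3)] -/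
def degY (m : (ι ⊕ κ) →₀ ℕ) : ℕ := ∑ i, m (Sum.inl i)

/-- `A` — the exponent in the BASE block `u` of a monomial `y^B u^A`, as a function `κ → ℕ`. [cite: CossartJannsenSaito2020, Ch. 7 (7.3)] -/
def expU (m : (ι ⊕ κ) →₀ ℕ) : κ → ℕ := fun j => m (Sum.inr j)

/-- `n_(u)(g)` — the order of `g mod ⟨u⟩` (CJS (7.2): `n_(u)(f) = v_{𝔪̃}(f̃)`, `f̃ = f mod ⟨u⟩`), rendered for polynomials as the order at the origin of `g` with the base
letters set to `0`; `⊤` iff `g ∈ ⟨u⟩`. [cite: CossartJannsenSaito2020, Ch. 7 (7.2)] -/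
noncomputable def yOrderModU (g : MvPolynomial (ι ⊕ κ) K) : ℕ∞ :=
  ordZero (aeval (Sum.elim (fun i => (X i : MvPolynomial ι K)) (fun _ => 0)) g)

/-- **`δ_L(g, y, u)`** for a linear form `L` on the base exponents (given by its coefficients `L : κ → ℚ`) and the pivot order `n` (= `n_(u)(g)`):
`min { L(A) / (n − |B|) : C_{A,B} ≠ 0, |B| < n }`, in `WithTop ℚ` (`⊤` iff no monomial of `g` has `|B| < n`). [cite: CossartJannsenSaito2020, Def. 8.2 (3)] -/
def deltaL (L : κ → ℚ) (n : ℕ) (g : MvPolynomial (ι ⊕ κ) K) : WithTop ℚ :=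
  (g.support.filter fun m => degY m < n).inf fun m => (((∑ j, L j * (expU m j : ℚ)) / ((n - degY m : ℕ) : ℚ) : ℚ) : WithTop ℚ)

/-- **`δ(g, y, u)`** — the δ-invariant: `δ_{L₀}` for `L₀(A) = |A|` (CJS Def. 8.1 (3) with Def. 8.2 (3)): `min { |A| / (n − |B|) : C_{A,B} ≠ 0, |B| < n }`. [cite: CossartJannsenSaito2020, Def. 8.1 (3)] -/
def delta (n : ℕ) (g : MvPolynomial (ι ⊕ κ) K) : WithTop ℚ := deltaL (fun _ => (1 : ℚ)) n g

/-- A monomial `y^B u^A` of `g` with `|B| < n` bounds `δ_L` from above by `L(A) / (n − |B|)` (the «min» of the definition). [cite: CossartJannsenSaito2020, Def. 8.2 (3)] -/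
theorem deltaL_le_of_mem_support (L : κ → ℚ) (n : ℕ) (g : MvPolynomial (ι ⊕ κ) K) {m : (ι ⊕ κ) →₀ ℕ} (hm : m ∈ g.support) (hB : degY m < n) :
    deltaL L n g ≤ (((∑ j, L j * (expU m j : ℚ)) / ((n - degY m : ℕ) : ℚ) : ℚ) : WithTop ℚ) :=
  Finset.inf_le (Finset.mem_filter.mpr ⟨hm, hB⟩)

/-- `δ_L = ⊤` iff NO monomial of `g` has pivot degree `< n` (the `min` of the definition ranges over the empty set: the polyhedron has no generating point). [cite: CossartJannsenSaito2020, Def. 8.2 (3)] -/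
theorem deltaL_eq_top_iff (L : κ → ℚ) (n : ℕ) (g : MvPolynomial (ι ⊕ κ) K) :
    deltaL L n g = ⊤ ↔ ∀ m ∈ g.support, n ≤ degY m := by
  rw [deltaL, Finset.inf_eq_top_iff]
  constructor
  · intro h m hm
    by_contra hlt
    exact WithTop.coe_ne_top (h m (Finset.mem_filter.mpr ⟨hm, not_le.mp hlt⟩))
  · intro h m hm
    obtain ⟨hm', hB⟩ := Finset.mem_filter.mp hm
    exact absurd hB (not_lt.mpr (h m hm'))

/-- With `L₀ = |·|`: a monomial `y^B u^A` of `g` with `|B| < n` bounds `δ(g, y, u)` by `|A| / (n − |B|)`. [cite: CossartJannsenSaito2020, Def. 8.1 (3)] -/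
theorem delta_le_of_mem_support (n : ℕ) (g : MvPolynomial (ι ⊕ κ) K) {m : (ι ⊕ κ) →₀ ℕ} (hm : m ∈ g.support) (hB : degY m < n) :
    delta n g ≤ (((∑ j, (expU m j : ℚ)) / ((n - degY m : ℕ) : ℚ) : ℚ) : WithTop ℚ) := by
  have h := deltaL_le_of_mem_support (fun _ => (1 : ℚ)) n g hm hB
  simpa [delta] using h

end Literature.AlgebraicGeometry.Resolution.CossartJannsenSaito
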